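import Summits.BirchSwinnertonDyer.BirchSwinnertonDyer.Theorems.PrintCf2SplitBadTwoLevelModelsPointed
import Summits.BirchSwinnertonDyer.BirchSwinnertonDyer.Theorems.PrintCf2SplitBadTwoLevelSurjOfClassProNullTwisted
import Summits.BirchSwinnertonDyer.BirchSwinnertonDyer.Theorems.PrintCf2SplitBadTwoLocSurjTrivialAssembly
import Summits.BirchSwinnertonDyer.BirchSwinnertonDyer.Theorems.PrintCf2SplitBadTwoLocSurjOfLevels
import Summits.BirchSwinnertonDyer.BirchSwinnertonDyer.Theorems.PrintCf2SplitBadTwoTwistedLayerField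
import Summits.BirchSwinnertonDyer.BirchSwinnertonDyer.Theorems.PrintCf2SplitBadTwoUpperBaseLiftFrameLayers
import Literature.NumberTheory.GaloisRepresentations.GaloisRepUnramifiedProofs
import HarnessLib

/-!
# Crux `PrintCf2.SplitBadTwoRankOneOfFacts` (stmt-BirchSwinnertonDyer-20368), registered stub (REG₂) `stub_xRegular_two`, S3N-FACTFREE road R2,
# ROAD (b) END-TO-END FOR SIGN-TWISTED COEFFICIENTS, MODULO THE TWISTED `v̄`-READING «B5-T»: (LSₙ) over every layer `K*_n` of the
# `ℤ_p`-line unramified outside `v̄` for a discrete `A ≅ ℚ_p/ℤ_p(ε)` (`Γ_K` acting through a sign `ε : Γ_K →* ℤˣ`): pointed models (B3e′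
# p707877) ∘ twisted class-level (PRO-NULL)_U (B3d′ p706910 ∘ -w4 g14 p705557) ∘ B3c (p706017) ∘ -w4 g12 (p700951), with ONE displayed
# hypothesis `hB5T` = B3d′'s `hB5` UNIVERSALLY QUANTIFIED over the level `M`, the models and the twisted layer field `F′` (the socket of
# -w3 g14 / -w4 g14's «B5-T» bricks, in flight)

Cell `bsd-print-cf2`, WIDTH seat `bsd-line-cf2-p1-w8` g5 (prover-bsd-line-cf2-p1-w8-g5-0); `--supports stmt-BirchSwinnertonDyer-20368`
(helper, Theses-free). HONEST FRAMING: nothing here closes the crux or a registered stub; BSD is not proved by any of this; no summit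
statement is proved by this seat. No definition, no named fact, no `sorry`. CONDITIONAL only on the displayed `hB5T`.

WHAT.
* **`locSurj_torsionExponent_twisted`** — `U = Gal(K̄/F)` open normal, `F′ ⊇ F` with `Gal(K̄/F′) = U ∩ ker ε` (`hU′`, `hεU′`, `hker`; `F′/K`
  finite abelian), `I_w ≤ U` off `p`, `ε` unramified outside a finite `Sε` (`hSε`), `A` discrete with `σ • a = ε(σ) • a` and `A ≃+ ℚ_p/ℤ_p`:
  GIVEN `hB5T`, (SUR_U) holds for every `p^k`-torsion target family — VERBATIM the `hLSk k` body of `UpperBaseLift.locSurj_of_forall_torsionExponent`.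
* **`locSurj_layers_twisted`** — on the `ℤ_p`-line `κ` unramified outside `v̄` (`p ∤ h_K`): GIVEN `hB5T` (quantified over the twisted layer
  fields `F′` with `Gal(K̄/F′) = κ.layerSubgroup n ∩ ker ε`, -w4 g14 `exists_twistedLayerField`), (LSₙ) for `A` at EVERY layer — VERBATIM the
  `hLSn n` body of `UpperBaseLift.locSurj_of_layers` / `XRegPinned.xRegular_char_of_layers`.
The antecedents offered to `hB5T` are exactly what the pointed models export (`σ • x = ε(σ) • x` on `N`, `p^M • N = 0`, `B` equivariant and
right-perfect, `N′` finite with `p^M • N′ = 0`, `ι′` injective, `ε`-twisted-equivariant and `B`-represented through `m₀`). USE: with -w7 g6's `θ = 1` closers (p707251 lineage) and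
B5-T, -w2 g14's socket `XRegPinned.stub_xRegular_two_of_locSurjLayers` (p704095) closes (REG₂) by name (`A := charModule ∅ θ`,
`ε :=` the sign of `θ`, -w4 g14 `exists_signHom_of_sq_eq_one`, `e := charModuleEquiv`). presearch: GV2000 §2 Prop. 2.1; Greenberg LNM 1716
§4; NSW (1.6.6)–(1.6.7) — assembly of tree theorems, no new fact. beyond-print theorem: no.

References: [GreenbergVatsal2000] §2 Prop. 2.1; [GreenbergLNM1716] §4 Props. 4.13–4.15; [deShalit1987] III.2.3;
[NeukirchSchmidtWingberg2008] (1.6.6)–(1.6.7).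
-/

noncomputable section

open scoped Classical ContRepresentation Pointwise

set_option linter.dupNamespace false
set_option autoImplicit false

open CategoryTheory NumberField IsDedekindDomain Field ValuativeRel
open Literature.NumberTheory.EllipticCurves Literature.NumberTheory.EllipticCurves.GreenbergSelmer
open Literature.NumberTheory.EllipticCurves.GreenbergVatsal2000
open Literature.NumberTheory.GaloisRepresentations Literature.NumberTheory.GaloisRepresentations.LocalWeilDatum
open Literature.NumberTheory.GaloisRepresentations.DiscreteGaloisModule (SelmerStructure mu MuCarrier TateDual tateDual
  coindTateDualMor coindTateDualHom)
open Literature.NumberTheory.GaloisCohomology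
open Literature.NumberTheory.IwasawaTheory
open Summit.BirchSwinnertonDyer.Rank1Residual.X11b.LocBridge

namespace Summit.BirchSwinnertonDyer.BirchSwinnertonDyer.Theorems.PrintCf2.LayerShapiro

variable {K : Type} [Field K] [NumberField K] {p : ℕ} [Fact p.Prime]

/-- **(SUR_U) FOR EVERY `p^k`-TORSION TARGET FAMILY, SIGN-TWISTED COEFFICIENTS `A ≅ ℚ_p/ℤ_p(ε)`, MODULO «B5-T».** See the module
docstring. [cite: GreenbergVatsal2000, §2 Prop. 2.1] [cite: deShalit1987, III.2.3] [cite: NeukirchSchmidtWingberg2008, (1.6.6)–(1.6.7)] -/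
theorem locSurj_torsionExponent_twisted (hK : IsImaginaryQuadratic K) {v vbar : HeightOneSpectrum (𝓞 K)}
    (hv : ((p : ℕ) : 𝓞 K) ∈ v.asIdeal) (hvbar : ((p : ℕ) : 𝓞 K) ∈ vbar.asIdeal) (hne : vbar ≠ v)
    (hall : ∀ w : HeightOneSpectrum (𝓞 K), ((p : ℕ) : 𝓞 K) ∈ w.asIdeal → w = v ∨ w = vbar)
    (U : Subgroup (absoluteGaloisGroup K)) [U.Normal] (hUopen : IsOpen (U : Set (absoluteGaloisGroup K)))
    [Fintype (absoluteGaloisGroup K ⧸ U)]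
    (F F' : IntermediateField K (AlgebraicClosure K)) [FiniteDimensional K F'] [IsAbelianGalois K F'] [NumberField F']
    [(galFixing K F').Normal] (ε : absoluteGaloisGroup K →* ℤˣ) (hε : IsOpen (ε.ker : Set (absoluteGaloisGroup K)))
    (hUF : galFixing K F = U) (hU' : galFixing K F' ≤ U) (hεU' : ∀ u ∈ galFixing K F', ε u = 1)
    (hker : ∀ u ∈ U, ε u = 1 → u ∈ galFixing K F')
    (hIU : ∀ w : HeightOneSpectrum (𝓞 K), ((p : ℕ) : 𝓞 K) ∉ w.asIdeal → GreenbergSelmer.inertia w ≤ U)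
    (Sε : Finset (HeightOneSpectrum (𝓞 K)))
    (hSε : ∀ w : HeightOneSpectrum (𝓞 K), w ∉ Sε → ((p : ℕ) : 𝓞 K) ∉ w.asIdeal → ∀ τ ∈ GreenbergSelmer.inertia w, ε τ = 1)
    {A : Type} [AddCommGroup A] [DistribMulAction (absoluteGaloisGroup K) A] [TopologicalSpace A] [DiscreteTopology A]
    (hA : ∀ a : A, IsOpen {σ : absoluteGaloisGroup K | σ • a = a})
    (hAε : ∀ (σ : absoluteGaloisGroup K) (a : A), σ • a = ((ε σ : ℤˣ) : ℤ) • a) (e : A ≃+ QpModZp p)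
    (hB5T : ∀ (M : ℕ) {N : Type} [AddCommGroup N] [DistribMulAction (absoluteGaloisGroup K) N] [TopologicalSpace N]
        [DiscreteTopology N] [Finite N]
      {N' : Type} [AddCommGroup N'] [DistribMulAction (absoluteGaloisGroup K) N'] [TopologicalSpace N'] [DiscreteTopology N']
      [Finite N']
      (hN : ∀ m : N, IsOpen {σ : absoluteGaloisGroup K | σ • m = m}) (hN' : ∀ m : N', IsOpen {σ : absoluteGaloisGroup K | σ • m = m})
      (_ : ∀ (σ : absoluteGaloisGroup K) (x : N), σ • x = ((ε σ : ℤˣ) : ℤ) • x) (_ : ∀ x : N, p ^ M • x = 0)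
      (_ : ∀ x : N', p ^ M • x = 0)
      (B : N →+ N' →+ MuCarrier K (p ^ M))
      (hB : ∀ (σ : absoluteGaloisGroup K) (m : N) (m' : N'), B (ofSMul N hN σ m) (ofSMul N' hN' σ m') = mu K (p ^ M) σ (B m m'))
      (_ : Function.Bijective fun m' : N' ↦ B.flip m')
      (ι' : N' →+ Additive (AlgebraicClosure K)ˣ) (_ : Function.Injective ι')
      (_ : ∀ (g : absoluteGaloisGroup K) (x : N'), Additive.toMul (ι' (g • x)) = (g • Additive.toMul (ι' x)) ^ ((ε g : ℤˣ) : ℤ))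
      (m₀ : N) (_ : ∀ m' : N', Additive.toMul (ι' m') = muVal K (p ^ M) (B m₀ m'))
      {s : absoluteGaloisGroup K ⧸ U → absoluteGaloisGroup K}
      (hs : ∀ y, (s y : absoluteGaloisGroup K ⧸ U) = y) (hs1 : s ((1 : absoluteGaloisGroup K) : absoluteGaloisGroup K ⧸ U) = 1)
      (φ : contOneCocycles (discreteTopRep U N')),
      galoisCohomology.localization (((ofSMul N hN).coind U hUopen).tateDual (p ^ M)) (Sum.inr vbar) 1
          (cohomologyMap (coindTateDualMor (ofSMul N hN) (ofSMul N' hN') U B hUopen hB) 1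
            (shapiroLift (ofSMul N' hN').toTopRep U hUopen hs hs1 (oneCocycleClass _ φ))) ∈
        (LocalInvariants.canonical K (p ^ M)).dualLocalCondition ((ofSMul N hN).coind U hUopen) (Sum.inr vbar)
          (DiscreteGaloisModule.unramifiedSubgroup (GaloisRep.toLocal vbar ((ofSMul N hN).coind U hUopen)) 1) →
      ∀ β : (AlgebraicClosure K)ˣ,
        (∀ u : galFixing K F', Additive.toMul (ι' (φ.1 ⟨u, hU' u.2⟩)) = (u : absoluteGaloisGroup K) • β / β) →
        ∀ b : F', ((b : F') : AlgebraicClosure K) = ((β ^ p ^ M : (AlgebraicClosure K)ˣ) : AlgebraicClosure K) →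
        ∀ w' : vbar.Extension (𝓞 F'),
          ((p ^ M : ℕ) : ℤ) ∣ WithZero.log (w'.1.valuation F' b) ∨
          ∃ 𝔓 : Ideal (absIntegers (𝓞 K) K),
            𝔓.comap (ringOfIntegersToIntegralClosure (k := K) (Ω := AlgebraicClosure K) F') = w'.1.asIdeal ∧
            ∃ s ∈ U, ε s ≠ 1 ∧ s • 𝔓 = 𝔓)
    (k : ℕ) :
    ∀ (T : Finset (HeightOneSpectrum (𝓞 K))), (∀ w ∈ T, ((p : ℕ) : 𝓞 K) ∉ w.asIdeal ∨ w = vbar) →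
      ∀ τ : (w : HeightOneSpectrum (𝓞 K)) →
        DoubleCoset.Quotient (decomp (K := K) w : Set (absoluteGaloisGroup K)) (U : Set (absoluteGaloisGroup K)) →
          subgroupH1 (decompIn U w) A,
      (∀ w ∈ T, ∀ q, p ^ k • τ w q = 0) →
      ∃ z : subgroupH1 U A,
        (∀ w ∈ T, ∀ q : DoubleCoset.Quotient (decomp (K := K) w : Set (absoluteGaloisGroup K)) (U : Set (absoluteGaloisGroup K)),
          resOfLe A (inertiaIn_le_decompIn U w)
            (resH1Hom (decompInToH U w) (AddMonoidHom.id A) (fun _ _ ↦ rfl) (conjH1 U A q.out z) - τ w q) = 0) ∧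
        (∀ w : HeightOneSpectrum (𝓞 K), w ∉ T → (((p : ℕ) : 𝓞 K) ∉ w.asIdeal ∨ w = vbar) →
          ∀ σ : absoluteGaloisGroup K, conjH1 U A σ z ∈ GreenbergVatsal2000.unramifiedKer U A w) := by
  subst hUF
  -- the level `M` of the twisted class-level (PRO-NULL)_U, through B3d′
  obtain ⟨M, hkM, hM⟩ := exists_level_levelSurj_of_classProNull_twisted (p := p) hK hv hvbar hne hall F F' ε hU' hεU' hker hUopen k
  -- the pointed models for the sign `ε`
  obtain ⟨N₀, N, N₀', N', _, _, _, _, _, _, _, _, _, _, _, _, _, _, _, _, _, _, hN₀, hN, hN₀', hN', j, ι₀, ι, B, B₀, jD, ι', ι₀',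
    hN₀ε, hNε, hMN, hj, hι₀eq, hι₀inj, hrange, hιeq, hcomp, hdiv, hMN', hB, hBbij, hB₀, hjD, hBj, hι'inj, hι'eq, hι₀'inj, hι₀'eq,
    hι₀'surj, htι, m₀, hι'B⟩ :=
    exists_signLevelModels_pointed (p := p) ε hε hAε e k M hkM
  -- ramification of the coinduced level: unramified where `ε` is, else the sign escape
  have hunr : ∀ w : HeightOneSpectrum (𝓞 K), ((p : ℕ) : 𝓞 K) ∉ w.asIdeal → (∀ τ ∈ GreenbergSelmer.inertia w, ε τ = 1) →
      GaloisRep.IsUnramifiedAt w ((ofSMul N hN).coind (galFixing K F) hUopen) := fun w hw hεw ↦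
    isUnramifiedAt_coind_of_inertia_le (galFixing K F) hUopen hN w (hIU w hw) fun σ hσ x ↦ by
      rw [hNε, hεw σ hσ, Units.val_one, one_zsmul]
  have hSε' : ∀ w : HeightOneSpectrum (𝓞 K), w ∉ Sε → ((p : ℕ) : 𝓞 K) ∉ w.asIdeal →
      GaloisRep.IsUnramifiedAt w ((ofSMul N hN).coind (galFixing K F) hUopen) := fun w hw hpw ↦ hunr w hpw (hSε w hw hpw)
  have hram : ∀ w : HeightOneSpectrum (𝓞 K), ((p : ℕ) : 𝓞 K) ∉ w.asIdeal →
      GaloisRep.IsUnramifiedAt w ((ofSMul N hN).coind (galFixing K F) hUopen) ∨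
      (GreenbergSelmer.inertia w ≤ galFixing K F ∧ ∃ τ ∈ GreenbergSelmer.inertia w, ε τ ≠ 1) := fun w hw ↦ by
    by_cases h : ∀ τ ∈ GreenbergSelmer.inertia w, ε τ = 1
    · exact Or.inl (hunr w hw h)
    · simp only [not_forall, exists_prop] at h
      obtain ⟨τ, hτ, hετ⟩ := h
      exact Or.inr ⟨hIU w hw, τ, hτ, hετ⟩
  -- `N′` is finite (`B` right-perfect, `N` and `μ_{p^M}` finite)
  haveI : Finite N' := by
    haveI : NeZero (p ^ M) := ⟨pow_ne_zero _ (Fact.out : p.Prime).ne_zero⟩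
    haveI : Finite (MuCarrier K (p ^ M)) := inferInstanceAs (Finite (Additive (rootsOfUnity (p ^ M) (AlgebraicClosure K))))
    exact Finite.of_injective (fun m' : N' ↦ ((B.flip m' : N →+ MuCarrier K (p ^ M)) : N → MuCarrier K (p ^ M)))
      (DFunLike.coe_injective.comp hBbij.1)
  -- B3c over B3d′, with the displayed twisted `v̄`-reading
  refine locSurj_torsionExponent_of_levelSurj (galFixing K F) hA vbar k hdiv ι₀ hι₀eq hι₀inj hrange ι hιeq j hj hcomp ?_
  exact hM hN₀ hN hN₀' hN' hMN hMN' j hj B hB hBbij B₀ hB₀ jD hjD hBj ι' hι'inj hι'eq ι₀' hι₀'inj hι₀'eq hι₀'surj htι Sε hSε' hram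
    (fun hs hs1 φ hφ ↦ hB5T M hN hN' hNε hMN hMN' B hB hBbij ι' hι'inj hι'eq m₀ hι'B hs hs1 φ hφ)


/-- **(LSₙ) FOR SIGN-TWISTED `A ≅ ℚ_p/ℤ_p(ε)` AT EVERY LAYER OF THE `ℤ_p`-LINE UNRAMIFIED OUTSIDE `v̄`, MODULO «B5-T»** (quantified over
the twisted layer fields `F′`, `Gal(K̄/F′) = κ.layerSubgroup n ∩ ker ε`). VERBATIM the `hLSn n` body of `UpperBaseLift.locSurj_of_layers`.
[cite: GreenbergVatsal2000, §2 Prop. 2.1] [cite: GreenbergLNM1716, §4 Props. 4.13–4.15] [cite: NeukirchSchmidtWingberg2008, (1.6.6)–(1.6.7)] -/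
theorem locSurj_layers_twisted (hK : IsImaginaryQuadratic K) {v vbar : HeightOneSpectrum (𝓞 K)}
    (hv : ((p : ℕ) : 𝓞 K) ∈ v.asIdeal) (hvbar : ((p : ℕ) : 𝓞 K) ∈ vbar.asIdeal) (hne : vbar ≠ v)
    (hall : ∀ w : HeightOneSpectrum (𝓞 K), ((p : ℕ) : 𝓞 K) ∈ w.asIdeal → w = v ∨ w = vbar)
    (κ : ZpExtension K p) (hκ : κ.IsUnramifiedOutside vbar)
    (ε : absoluteGaloisGroup K →* ℤˣ) (hε : IsOpen (ε.ker : Set (absoluteGaloisGroup K)))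
    (Sε : Finset (HeightOneSpectrum (𝓞 K)))
    (hSε : ∀ w : HeightOneSpectrum (𝓞 K), w ∉ Sε → ((p : ℕ) : 𝓞 K) ∉ w.asIdeal → ∀ τ ∈ GreenbergSelmer.inertia w, ε τ = 1)
    {A : Type} [AddCommGroup A] [DistribMulAction (absoluteGaloisGroup K) A] [TopologicalSpace A] [DiscreteTopology A]
    (hA : ∀ a : A, IsOpen {σ : absoluteGaloisGroup K | σ • a = a})
    (hAε : ∀ (σ : absoluteGaloisGroup K) (a : A), σ • a = ((ε σ : ℤˣ) : ℤ) • a) (e : A ≃+ QpModZp p) (n : ℕ)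
    [Fintype (absoluteGaloisGroup K ⧸ κ.layerSubgroup n)]
    (hB5T : ∀ (F' : IntermediateField K (AlgebraicClosure K)) [FiniteDimensional K F'] [IsAbelianGalois K F'] [NumberField F']
      [(galFixing K F').Normal] (hU' : galFixing K F' ≤ κ.layerSubgroup n) (_ : ∀ u ∈ galFixing K F', ε u = 1)
      (_ : ∀ u ∈ κ.layerSubgroup n, ε u = 1 → u ∈ galFixing K F')
      (M : ℕ) {N : Type} [AddCommGroup N] [DistribMulAction (absoluteGaloisGroup K) N] [TopologicalSpace N]
        [DiscreteTopology N] [Finite N]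
      {N' : Type} [AddCommGroup N'] [DistribMulAction (absoluteGaloisGroup K) N'] [TopologicalSpace N'] [DiscreteTopology N']
      [Finite N']
      (hN : ∀ m : N, IsOpen {σ : absoluteGaloisGroup K | σ • m = m}) (hN' : ∀ m : N', IsOpen {σ : absoluteGaloisGroup K | σ • m = m})
      (_ : ∀ (σ : absoluteGaloisGroup K) (x : N), σ • x = ((ε σ : ℤˣ) : ℤ) • x) (_ : ∀ x : N, p ^ M • x = 0)
      (_ : ∀ x : N', p ^ M • x = 0)
      (B : N →+ N' →+ MuCarrier K (p ^ M))
      (hB : ∀ (σ : absoluteGaloisGroup K) (m : N) (m' : N'), B (ofSMul N hN σ m) (ofSMul N' hN' σ m') = mu K (p ^ M) σ (B m m'))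
      (_ : Function.Bijective fun m' : N' ↦ B.flip m')
      (ι' : N' →+ Additive (AlgebraicClosure K)ˣ) (_ : Function.Injective ι')
      (_ : ∀ (g : absoluteGaloisGroup K) (x : N'), Additive.toMul (ι' (g • x)) = (g • Additive.toMul (ι' x)) ^ ((ε g : ℤˣ) : ℤ))
      (m₀ : N) (_ : ∀ m' : N', Additive.toMul (ι' m') = muVal K (p ^ M) (B m₀ m'))
      {s : absoluteGaloisGroup K ⧸ κ.layerSubgroup n → absoluteGaloisGroup K}
      (hs : ∀ y, (s y : absoluteGaloisGroup K ⧸ κ.layerSubgroup n) = y)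
      (hs1 : s ((1 : absoluteGaloisGroup K) : absoluteGaloisGroup K ⧸ κ.layerSubgroup n) = 1)
      (φ : contOneCocycles (discreteTopRep (κ.layerSubgroup n) N')),
      galoisCohomology.localization (((ofSMul N hN).coind (κ.layerSubgroup n) (κ.isOpen_layerSubgroup n)).tateDual (p ^ M))
          (Sum.inr vbar) 1
          (cohomologyMap (coindTateDualMor (ofSMul N hN) (ofSMul N' hN') (κ.layerSubgroup n) B (κ.isOpen_layerSubgroup n) hB) 1
            (shapiroLift (ofSMul N' hN').toTopRep (κ.layerSubgroup n) (κ.isOpen_layerSubgroup n) hs hs1 (oneCocycleClass _ φ))) ∈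
        (LocalInvariants.canonical K (p ^ M)).dualLocalCondition ((ofSMul N hN).coind (κ.layerSubgroup n) (κ.isOpen_layerSubgroup n))
          (Sum.inr vbar)
          (DiscreteGaloisModule.unramifiedSubgroup
            (GaloisRep.toLocal vbar ((ofSMul N hN).coind (κ.layerSubgroup n) (κ.isOpen_layerSubgroup n))) 1) →
      ∀ β : (AlgebraicClosure K)ˣ,
        (∀ u : galFixing K F', Additive.toMul (ι' (φ.1 ⟨u, hU' u.2⟩)) = (u : absoluteGaloisGroup K) • β / β) →
        ∀ b : F', ((b : F') : AlgebraicClosure K) = ((β ^ p ^ M : (AlgebraicClosure K)ˣ) : AlgebraicClosure K) →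
        ∀ w' : vbar.Extension (𝓞 F'),
          ((p ^ M : ℕ) : ℤ) ∣ WithZero.log (w'.1.valuation F' b) ∨
          ∃ 𝔓 : Ideal (absIntegers (𝓞 K) K),
            𝔓.comap (ringOfIntegersToIntegralClosure (k := K) (Ω := AlgebraicClosure K) F') = w'.1.asIdeal ∧
            ∃ s ∈ κ.layerSubgroup n, ε s ≠ 1 ∧ s • 𝔓 = 𝔓) :
    ∀ (T : Finset (HeightOneSpectrum (𝓞 K))), (∀ w ∈ T, ((p : ℕ) : 𝓞 K) ∉ w.asIdeal ∨ w = vbar) →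
      ∀ τ : (w : HeightOneSpectrum (𝓞 K)) →
        DoubleCoset.Quotient (decomp (K := K) w : Set (absoluteGaloisGroup K)) (κ.layerSubgroup n : Set (absoluteGaloisGroup K)) →
          subgroupH1 (decompIn (κ.layerSubgroup n) w) A,
      ∃ z : subgroupH1 (κ.layerSubgroup n) A,
        (∀ w ∈ T, ∀ q : DoubleCoset.Quotient (decomp (K := K) w : Set (absoluteGaloisGroup K))
            (κ.layerSubgroup n : Set (absoluteGaloisGroup K)),
          resOfLe A (inertiaIn_le_decompIn (κ.layerSubgroup n) w)
            (resH1Hom (decompInToH (κ.layerSubgroup n) w) (AddMonoidHom.id A) (fun _ _ ↦ rfl)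
              (conjH1 (κ.layerSubgroup n) A q.out z) - τ w q) = 0) ∧
        (∀ w : HeightOneSpectrum (𝓞 K), w ∉ T → (((p : ℕ) : 𝓞 K) ∉ w.asIdeal ∨ w = vbar) →
          ∀ σ : absoluteGaloisGroup K, conjH1 (κ.layerSubgroup n) A σ z ∈
            GreenbergVatsal2000.unramifiedKer (κ.layerSubgroup n) A w) := by
  -- the layer field `F` (ε = 1) and the twisted layer field `F′`
  have hε1 : IsOpen ((1 : absoluteGaloisGroup K →* ℤˣ).ker : Set (absoluteGaloisGroup K)) := by
    rw [MonoidHom.ker_one]; exact isOpen_univ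
  obtain ⟨F, hFU, -, hfd, hab, hnf, -⟩ := KummerUDict.exists_twistedLayerField κ n (1 : absoluteGaloisGroup K →* ℤˣ) hε1
  haveI := hfd; haveI := hab; haveI := hnf
  have hUF : galFixing K F = κ.layerSubgroup n := by rw [hFU, MonoidHom.ker_one, inf_top_eq]
  obtain ⟨F', hF'U, -, hfd', hab', hnf', hnorm'⟩ := KummerUDict.exists_twistedLayerField κ n ε hε
  haveI := hfd'; haveI := hab'; haveI := hnf'; haveI := hnorm'
  have hU' : galFixing K F' ≤ κ.layerSubgroup n := by rw [hF'U]; exact inf_le_left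
  have hεU' : ∀ u ∈ galFixing K F', ε u = 1 := fun u hu ↦ by
    rw [hF'U] at hu; exact (MonoidHom.mem_ker).1 hu.2
  have hker : ∀ u ∈ κ.layerSubgroup n, ε u = 1 → u ∈ galFixing K F' := fun u hu hεu ↦ by
    rw [hF'U]; exact ⟨hu, (MonoidHom.mem_ker).2 hεu⟩
  -- torsion, inertia
  have htor : ∀ a : A, ∃ k : ℕ, p ^ k • a = 0 := fun a ↦ by
    obtain ⟨k, hk⟩ := QpModZp.exists_pow_nsmul_eq_zero (e a)
    exact ⟨k, e.injective (by rw [map_nsmul, hk, map_zero])⟩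
  have hIU : ∀ w : HeightOneSpectrum (𝓞 K), ((p : ℕ) : 𝓞 K) ∉ w.asIdeal → GreenbergSelmer.inertia w ≤ κ.layerSubgroup n :=
    fun w hw ↦ (hκ.inertia_le fun h ↦ hw (by rw [h]; exact hvbar)).trans (κ.kerSubgroup_le_layerSubgroup n)
  exact UpperBaseLift.locSurj_layerSubgroup_of_forall_torsionExponent (M := A) κ n htor
    (UpperBaseLift.not_decomp_le_kerSubgroup_of_isUnramifiedOutside_or_eq hK hv hvbar hne κ hκ) fun k ↦
      locSurj_torsionExponent_twisted hK hv hvbar hne hall (κ.layerSubgroup n) (κ.isOpen_layerSubgroup n) F F' ε hε hUF hU' hεU'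
        hker hIU Sε hSε hA hAε e (by
          intro M N _ _ _ _ _ N' _ _ _ _ _ hN hN' hNε hMN hMN' B hB hBbij ι' hι'inj hι' m₀ hι'B s hs hs1 φ hφ
          exact hB5T F' hU' hεU' hker M hN hN' hNε hMN hMN' B hB hBbij ι' hι'inj hι' m₀ hι'B hs hs1 φ hφ) k

end Summit.BirchSwinnertonDyer.BirchSwinnertonDyer.Theorems.PrintCf2.LayerShapiro

end
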